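import Literature.Geometry.Riemannian.MetricFlowFLimitPairAux1
import Literature.Geometry.Riemannian.MetricFlowFDistanceTriangleFamily
import Literature.Geometry.Riemannian.MetricFlowFLimitKernelCauchy
import Literature.Geometry.Riemannian.MetricFlowFLimitKernelSupport
import HarnessLib

/-!
# The limit of a fast `𝔽`-Cauchy chain within a correspondence, II: the limit conjugate heat kernels
# (Bamler 2023, §5.4, Lemma 5.20, Claim 5.21)

R. Bamler, *Compactness theory of the space of super Ricci flows*, Invent. Math. 233 (2023), §5.4,
proof of Lemma 5.20 (arXiv v1 Lemma 121), Claim 5.21 (arXiv v1 Claim 122): *"For every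
`s, t ∈ I ∖ E^∞`, `s ≤ t` and `x^∞ ∈ X^∞_t` and every sequence `xⁱ ∈ 𝒳ⁱ_t` with `φⁱ_t(xⁱ) → x^∞` we
have `(φⁱ_s)_* νⁱ_{xⁱ;s} → ν^∞_{x^∞;s}` in `W₁`, for some probability measure
`ν^∞_{x^∞;s} ∈ 𝒫(Z_s)` with `supp ν^∞_{x^∞;s} ⊆ X^∞_s`. Moreover, the limit does not depend on the
choice of the sequence `xⁱ`."*

Continuing `MetricFlowFLimitPairAux1.lean` (the bundled fast chain `S : ChainSetup I₀`, its good
times `S.G i`, limit times `S.I'` and limit measures `S.m t ht = μ^∞_t`), this file assembles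
Claim 5.21 from the landed analytic bricks (`cauchySeq_map_condKernel_of_chain`, the completeness
of `(𝒫(Z_s), d_{W₁})`, `support_subset_of_kernel_limit`):

* `ChainSetup.fDistWithin_lt_of_le` — the tail of the chain is `𝔽`-close within `ℭ` over the good
  times, `d^{ℭ, G i}_𝔽(P (i+k), P (i+l)) < 4 · 2^{-(i+k)}` for `k ≤ l` (Prop. 5.14 along the chain;
  the case `k = l` through the diagonal couplings);
* `ChainSetup.kpush n hs ht x = (φⁿ_s)_* νⁿ_{x;s}` and its `1`-Lipschitz dependence on `x`, also
  across two ways of writing the index (`wassersteinW1_kpush_le_edist'`);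
* `ChainSetup.IsKernelLimit`, `ChainSetup.exists_isKernelLimit` — Claim 5.21: existence of a
  probability measure `ν` on `Z_s` which is the `W₁`-limit of `(φ^{i+k}_s)_* ν^{i+k}_{x_k;s}` along
  EVERY stage `i` and EVERY sequence `x_k ∈ 𝒳^{i+k}_t` with `φ^{i+k}_t(x_k) → z` (independence of
  the sequence: two approximating sequences have `d_t(x_k, x'_k) → 0`, and the kernels are
  `1`-Lipschitz in `d_{W₁}`);
* `ChainSetup.νZ hs ht z = ν^∞_{z;s} ∈ 𝒫(Z_s)` (a definite choice of the limit), with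
  `tendsto_kpush_νZ` and `support_νZ_subset` (`supp ν^∞_{z;s} ⊆ X^∞_s`).

## References

* R. H. Bamler, *Compactness theory of the space of super Ricci flows*, Invent. Math. 233 (2023),
  1121–1277 (arXiv:2008.09298), §5.4, Lemma 5.20 and Claim 5.21 in its proof (arXiv v1 Lemma 121,
  Claim 122); §5.2, Prop. 5.14; §3.2, Prop. 3.24 (c). [Bamler2023]
-/

noncomputable section

open Set MeasureTheory Filter TopologicalSpace Function
open scoped Topology ENNReal NNReal

namespace Literature.Geometry.Riemannian

universe u

namespace MetricFlowPair

open MetricFlow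

namespace ChainSetup

variable {I₀ : Set ℝ} (S : ChainSetup.{u} I₀)

/-! ### `𝔽`-closeness of the tail over the good times -/

/-- Admissibility with exceptional set `E` only uses `J ⊆ I'' ∖ E`: the same witnesses serve every
`J' ⊆ I'' ∖ E`. [cite: Bamler2023, §5.1, Def. 5.6 (F-distance within correspondence)] -/
theorem _root_.Literature.Geometry.Riemannian.MetricFlowPair.FDistAdmissibleWith.of_subset
    {I₁ I₂ : Set ℝ} {P₁ : MetricFlowPair.{u} I₁} {P₂ : MetricFlowPair.{u} I₂} {I'' : Set ℝ}
    {ℭ : Correspondence₂ P₁.flow P₂.flow I''} {E J J' : Set ℝ} {r : ℝ}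
    (h : FDistAdmissibleWith P₁ P₂ ℭ E J r) (hJ' : J' ⊆ I'' \ E) :
    FDistAdmissibleWith P₁ P₂ ℭ E J' r := by
  obtain ⟨hr, hEm, hEI, -, hE₁, hE₂, hvol, q, hq, hint⟩ := h
  exact ⟨hr, hEm, hEI, hJ', hE₁, hE₂, hvol, q, hq, hint⟩

/-- `d^{ℭ, G i}_𝔽(P n, P (n+1)) ≤ 2^{-n}` for `i ≤ n`.
[cite: Bamler2023, §5.4, Lemma 5.20 (arXiv v1 Lemma 121), proof] -/
theorem fDistWithin_succ_le {i n : ℕ} (hin : i ≤ n) :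
    fDistWithin (S.P n) (S.P (n + 1)) (S.ℭ.pair n (n + 1)) (S.G i) ≤ ENNReal.ofReal (2⁻¹ ^ n) :=
  fDistWithin_le ((S.hE n).of_subset (S.G_subset_diff hin)).fDistAdmissible

/-- **The self-distance within `ℭ` is small**: every `r ≥ 2^{-n}` is admissible for
`d^{ℭ.pair n n, G i}_𝔽(P n, P n)`, `i ≤ n`, with `E := E n` and the diagonal couplings
`(id, id)_* μⁿ_t` (the integrand vanishes on the diagonal: `d_{W₁}(ν, ν) = 0`).
[cite: Bamler2023, §5.1, Def. 5.6 (F-distance within correspondence)] -/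
theorem fDistAdmissible_self {i n : ℕ} (hin : i ≤ n) {r : ℝ} (hr : 2⁻¹ ^ n ≤ r) :
    FDistAdmissible (S.P n) (S.P n) (S.ℭ.pair n n) (S.G i) r := by
  have hr0 : 0 < r := lt_of_lt_of_le (by positivity) hr
  have hd : I₀ \ S.E n ⊆ S.ℭ.dom n := S.hdom₁ n
  refine ⟨hr0, S.E n, S.measurableSet_E n, S.E_subset n, S.G_subset_diff hin, hd, hd, ?_,
    fun t ht ↦ ((S.P n).μ ⟨t, (S.ℭ.dom_subset n (hd ht)).1⟩).map fun x ↦ (id x, id x),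
    fun t ht ↦ ?_, fun s hs t ht hst ↦ ?_⟩
  · exact (S.hE n).volume_le.trans (ENNReal.ofReal_le_ofReal
      (pow_le_pow_left₀ (by positivity) hr 2))
  · haveI := (S.P n).isProbabilityMeasure_μ ⟨t, (S.ℭ.dom_subset n (hd ht)).1⟩
    exact ⟨Measure.isProbabilityMeasure_map (measurable_id.prodMk measurable_id).aemeasurable,
      by rw [Measure.fst_map_prodMk measurable_id, Measure.map_id],
      by rw [Measure.snd_map_prodMk measurable_id, Measure.map_id]⟩
  · refine (lintegral_map_le _ _).trans ?_
    have h0 : ∀ x : (S.P n).flow.Slice ⟨t, (S.ℭ.dom_subset n (hd ht)).1⟩,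
        kernelDistWithin (S.P n) (S.P n) (S.ℭ.pair n n) (hd hs) (hd hs) (hd ht) (hd ht)
          (id x, id x) = 0 := fun x ↦ by
      haveI := (S.P n).flow.isProbabilityMeasure_condKernel x
        (s := ⟨s, (S.ℭ.dom_subset n (hd hs)).1⟩) hst
      show wassersteinW1 (((S.P n).flow.condKernel x ⟨s, (S.ℭ.dom_subset n (hd hs)).1⟩).map
          (S.ℭ.φ n s (hd hs))) (((S.P n).flow.condKernel x ⟨s, (S.ℭ.dom_subset n (hd hs)).1⟩).map
          (S.ℭ.φ n s (hd hs))) = 0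
      refine le_antisymm ?_ zero_le
      exact (wassersteinW1_map_le_of_edist_le (S.ℭ.isometry n s (hd hs)).continuous.measurable
        (fun a b ↦ ((S.ℭ.isometry n s (hd hs)).edist_eq a b).le) _ _).trans_eq
        (wassersteinW1_self _)
    simp only [h0, lintegral_zero]
    exact zero_le

/-- `d^{ℭ.pair n n, G i}_𝔽(P n, P n) ≤ 2^{-n}` for `i ≤ n`.
[cite: Bamler2023, §5.1, Def. 5.6 (F-distance within correspondence)] -/
theorem fDistWithin_self_le {i n : ℕ} (hin : i ≤ n) :
    fDistWithin (S.P n) (S.P n) (S.ℭ.pair n n) (S.G i) ≤ ENNReal.ofReal (2⁻¹ ^ n) :=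
  fDistWithin_le (S.fDistAdmissible_self hin le_rfl)

/-- The chain bound within `ℭ` over the good times:
`d^{ℭ, G i}_𝔽(P n, P (n+j)) ≤ 2^{-n} + ∑_{l<j} 2^{-(n+l)} = 3 · 2^{-n} − 2 · 2^{-(n+j)}` for `i ≤ n`
(Prop. 5.14, `fDistWithinFamily_triangle`, by induction on `j`).
[cite: Bamler2023, §5.2, Prop. 5.14; §5.4, Lemma 5.20 (arXiv v1 Lemma 121), proof] -/
theorem fDistWithin_chain_le {i n : ℕ} (hin : i ≤ n) (j : ℕ) :
    fDistWithin (S.P n) (S.P (n + j)) (S.ℭ.pair n (n + j)) (S.G i) ≤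
      ENNReal.ofReal (3 * 2⁻¹ ^ n - 2 * 2⁻¹ ^ (n + j)) := by
  induction j with
  | zero =>
      show fDistWithin (S.P n) (S.P n) (S.ℭ.pair n n) (S.G i) ≤
        ENNReal.ofReal (3 * 2⁻¹ ^ n - 2 * 2⁻¹ ^ n)
      exact (S.fDistWithin_self_le hin).trans (ENNReal.ofReal_le_ofReal (by linarith))
  | succ j ih =>
      have h1 : (2⁻¹ : ℝ) ^ (n + j) ≤ 2⁻¹ ^ n :=
        pow_le_pow_of_le_one (by norm_num) (by norm_num) (Nat.le_add_right n j)
      calc fDistWithin (S.P n) (S.P (n + (j + 1))) (S.ℭ.pair n (n + (j + 1))) (S.G i)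
          ≤ fDistWithin (S.P n) (S.P (n + j)) (S.ℭ.pair n (n + j)) (S.G i) +
              fDistWithin (S.P (n + j)) (S.P (n + j + 1)) (S.ℭ.pair (n + j) (n + j + 1)) (S.G i) :=
            fDistWithinFamily_triangle S.P S.ℭ n (n + j) (n + j + 1) ⟨S.H, S.hP _⟩ ⟨S.H, S.hP _⟩
              ⟨S.H, S.hP _⟩ (S.G i)
        _ ≤ ENNReal.ofReal (3 * 2⁻¹ ^ n - 2 * 2⁻¹ ^ (n + j)) + ENNReal.ofReal (2⁻¹ ^ (n + j)) :=
            add_le_add ih (S.fDistWithin_succ_le (hin.trans (Nat.le_add_right n j)))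
        _ = ENNReal.ofReal (3 * 2⁻¹ ^ n - 2 * 2⁻¹ ^ (n + (j + 1))) := by
            rw [← ENNReal.ofReal_add
              (by linarith [h1, pow_nonneg (by norm_num : (0 : ℝ) ≤ 2⁻¹) (n + j)])
              (by positivity), show n + (j + 1) = (n + j) + 1 from rfl, pow_succ]
            ring_nf

/-- The `𝔽`-distance within `ℭ` does not depend on the way the second index is written. [folklore]
-/
theorem fDistWithin_congr_right {a b b' : ℕ} (e : b = b') (J : Set ℝ) :
    fDistWithin (S.P a) (S.P b) (S.ℭ.pair a b) J =
      fDistWithin (S.P a) (S.P b') (S.ℭ.pair a b') J := by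
  subst e
  rfl

/-- **The tail is `𝔽`-close within `ℭ` over the good times**:
`d^{ℭ, G i}_𝔽(P (i+k), P (i+l)) < 4 · 2^{-(i+k)}` for `k ≤ l`.
[cite: Bamler2023, §5.4, Lemma 5.20 (arXiv v1 Lemma 121), proof] -/
theorem fDistWithin_lt_of_le (i k l : ℕ) (hkl : k ≤ l) :
    fDistWithin (S.P (i + k)) (S.P (i + l)) (S.ℭ.pair (i + k) (i + l)) (S.G i) <
      ENNReal.ofReal (4 * 2⁻¹ ^ (i + k)) := by
  have hpos : (0 : ℝ) < 2⁻¹ ^ (i + k) := by positivity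
  rw [S.fDistWithin_congr_right (show i + l = i + k + (l - k) by omega)]
  refine (S.fDistWithin_chain_le (Nat.le_add_right i k) (l - k)).trans_lt ?_
  refine (ENNReal.ofReal_lt_ofReal_iff (by positivity)).2 ?_
  linarith [pow_nonneg (by norm_num : (0 : ℝ) ≤ 2⁻¹) (i + k + (l - k))]

/-! ### The pushed-forward conjugate heat kernels `(φⁿ_s)_* νⁿ_{x;s}` -/

/-- `(φⁿ_s)_* νⁿ_{x;s} ∈ 𝒫(Z_s)` for `x ∈ 𝒳ⁿ_t`, `s, t ∈ I''^{,n}`.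
[cite: Bamler2023, §5.4, Lemma 5.20, Claim 5.21 (arXiv v1 Claim 122)] -/
def kpush (n : ℕ) {s t : ℝ} (hs₀ : s ∈ I₀) (hs : s ∈ S.ℭ.dom n) (ht : t ∈ S.ℭ.dom n)
    (x : (S.P n).flow.Slice ⟨t, (S.ℭ.dom_subset n ht).1⟩) :
    Measure (S.ℭ.Z ⟨s, hs₀⟩) :=
  ((S.P n).flow.condKernel x ⟨s, (S.ℭ.dom_subset n hs).1⟩).map (S.ℭ.φ n s hs)

/-- `(φⁿ_s)_* νⁿ_{x;s}` is a probability measure for `s ≤ t`.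
[cite: Bamler2023, §5.4, Lemma 5.20, Claim 5.21 (arXiv v1 Claim 122)] -/
theorem isProbabilityMeasure_kpush (n : ℕ) {s t : ℝ} (hs₀ : s ∈ I₀) (hs : s ∈ S.ℭ.dom n)
    (ht : t ∈ S.ℭ.dom n) (hst : s ≤ t) (x : (S.P n).flow.Slice ⟨t, (S.ℭ.dom_subset n ht).1⟩) :
    IsProbabilityMeasure (S.kpush n hs₀ hs ht x) := by
  haveI := (S.P n).flow.isProbabilityMeasure_condKernel x (s := ⟨s, (S.ℭ.dom_subset n hs).1⟩) hst
  exact Measure.isProbabilityMeasure_map (S.ℭ.isometry n s hs).continuous.measurable.aemeasurable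

/-- **The pushed kernels are `1`-Lipschitz in the base point**:
`d_{W₁}((φⁿ_s)_* νⁿ_{x;s}, (φⁿ_s)_* νⁿ_{y;s}) ≤ d_t(x, y)` (`H`-concentration, Prop. 3.24 (c)).
[cite: Bamler2023, §3.2, Prop. 3.24 (c); §5.4, Lemma 5.20, proof] -/
theorem wassersteinW1_kpush_le_edist (n : ℕ) {s t : ℝ} (hs₀ : s ∈ I₀) (hs : s ∈ S.ℭ.dom n)
    (ht : t ∈ S.ℭ.dom n) (hst : s ≤ t) (x y : (S.P n).flow.Slice ⟨t, (S.ℭ.dom_subset n ht).1⟩) :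
    wassersteinW1 (S.kpush n hs₀ hs ht x) (S.kpush n hs₀ hs ht y) ≤ edist x y :=
  (wassersteinW1_map_le_of_edist_le (S.ℭ.isometry n s hs).continuous.measurable
    (fun a b ↦ ((S.ℭ.isometry n s hs).edist_eq a b).le) _ _).trans
    ((S.hP n).wassersteinW1_condKernel_le_edist hst x y)

/-- The `1`-Lipschitz dependence across two spellings `n = n'` of the index, in terms of the images
in `Z_t`: `d_{W₁}((φⁿ_s)_* νⁿ_{x;s}, (φ^{n'}_s)_* ν^{n'}_{y;s}) ≤ d^Z_t(φⁿ_t x, φ^{n'}_t y)`.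
[cite: Bamler2023, §3.2, Prop. 3.24 (c); §5.4, Lemma 5.20, proof] -/
theorem wassersteinW1_kpush_le_edist' {n n' : ℕ} (e : n = n') {s t : ℝ} (hs₀ : s ∈ I₀)
    (ht₀ : t ∈ I₀) (hs : s ∈ S.ℭ.dom n) (ht : t ∈ S.ℭ.dom n) (hs' : s ∈ S.ℭ.dom n')
    (ht' : t ∈ S.ℭ.dom n') (hst : s ≤ t) (x : (S.P n).flow.Slice ⟨t, (S.ℭ.dom_subset n ht).1⟩)
    (y : (S.P n').flow.Slice ⟨t, (S.ℭ.dom_subset n' ht').1⟩) :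
    wassersteinW1 (S.kpush n hs₀ hs ht x) (S.kpush n' hs₀ hs' ht' y) ≤
      edist (S.ℭ.φ n t ht x : S.ℭ.Z ⟨t, ht₀⟩) (S.ℭ.φ n' t ht' y) := by
  subst e
  rw [(S.ℭ.isometry n t ht).edist_eq]
  exact S.wassersteinW1_kpush_le_edist n hs₀ hs ht hst x y

/-- **`∫ f dμⁿ_s = ∫ (∫ f dνⁿ_{x;s}) dμⁿ_t(x)`** for `s ≤ t` in `I'^{,n}` and measurable `f ≥ 0`:
the conjugate heat flow identity `μⁿ_s = ∫ νⁿ_{x;s} dμⁿ_t(x)` of the pair `P n`, integrated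
(`Measure.lintegral_bind`). [cite: Bamler2023, §3.2, Definition (conjugate heat flow)] -/
theorem lintegral_μ_eq_lintegral_lintegral (n : ℕ) {s t : (S.P n).I'} (hst : (s : ℝ) ≤ t)
    {f : (S.P n).flow.Slice s → ℝ≥0∞} (hf : Measurable f) :
    ∫⁻ y, f y ∂((S.P n).μ s) = ∫⁻ x, ∫⁻ y, f y ∂((S.P n).flow.condKernel x s) ∂((S.P n).μ t) := by
  have hb : (S.P n).μ s = ((S.P n).μ t).bind ((S.P n).flow.kernel hst) := by
    ext A hA
    rw [Measure.bind_apply hA ((S.P n).flow.kernel hst).measurable.aemeasurable]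
    exact (S.P n).isConjugateHeatFlow.2 s.2 t.2 hst A hA
  rw [hb, Measure.lintegral_bind ((S.P n).flow.kernel hst).measurable.aemeasurable hf.aemeasurable]
  rfl

/-! ### Claim 5.21: the limit kernels -/

/-- **Claim 5.21 at a fixed stage, existence**: for good times `s ≤ t` at stage `i`,
`z ∈ X^∞_t = supp μ^∞_t` and `x_k ∈ 𝒳^{i+k}_t` with `φ^{i+k}_t(x_k) → z`, the pushed kernels
`(φ^{i+k}_s)_* ν^{i+k}_{x_k;s}` `W₁`-converge to a probability measure on `Z_s` (they are Cauchy by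
`cauchySeq_map_condKernel_of_chain`, and `(𝒫(Z_s), d_{W₁})` is complete).
[cite: Bamler2023, §5.4, Lemma 5.20, Claim 5.21 (arXiv v1 Claim 122)] -/
theorem exists_tendsto_kpush {i : ℕ} {s t : ℝ} (hs : s ∈ S.G i) (ht : t ∈ S.G i) (hst : s ≤ t)
    {z : S.ℭ.Z ⟨t, ht.1⟩} (hz : z ∈ (S.m t (S.G_subset_I' i ht)).support)
    (x : ∀ k, (S.P (i + k)).flow.Slice ⟨t, (S.ℭ.dom_subset (i + k) (S.memDom ht k)).1⟩)
    (hx : Tendsto (fun k ↦ S.ℭ.φ (i + k) t (S.memDom ht k) (x k)) atTop (𝓝 z)) :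
    ∃ ν : Measure (S.ℭ.Z ⟨s, hs.1⟩), IsProbabilityMeasure ν ∧
      Tendsto (fun k ↦ wassersteinW1 (S.kpush (i + k) hs.1 (S.memDom hs k) (S.memDom ht k) (x k)) ν)
        atTop (𝓝 0) := by
  haveI := fun k ↦ S.isProbabilityMeasure_kpush (i + k) hs.1 (S.memDom hs k) (S.memDom ht k) hst
    (x k)
  have hC := cauchySeq_map_condKernel_of_chain S.P S.hP S.ℭ (i := i) (Jgood := S.G i)
    (fun k ↦ fun _ h ↦ S.memDom h k)
    (d := fun k ↦ 4 * 2⁻¹ ^ (i + k)) ?_ (fun k l hkl ↦ S.fDistWithin_lt_of_le i k l hkl) hs ht hst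
    x hx (fun r hr ↦ S.liminf_measure_ball_pos (S.G_subset_I' i ht) ht hz hx hr)
  · exact exists_tendsto_wassersteinW1_nhds_zero_of_cauchySeq hC
  · have h := (tendsto_pow_atTop_nhds_zero_of_lt_one (by norm_num : (0 : ℝ) ≤ 2⁻¹)
      (by norm_num : (2⁻¹ : ℝ) < 1)).comp (tendsto_add_atTop_nat i |>.congr fun k ↦ add_comm k i)
    simpa using h.const_mul 4

/-- **The defining property of the limit kernel `ν^∞_{z;s}`** (Claim 5.21, with the independence
built in): `ν` is the `W₁`-limit of `(φ^{i+k}_s)_* ν^{i+k}_{x_k;s}` for EVERY stage `i` at which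
`s, t` are good and EVERY sequence `x_k ∈ 𝒳^{i+k}_t` with `φ^{i+k}_t(x_k) → z`.
[cite: Bamler2023, §5.4, Lemma 5.20, Claim 5.21 (arXiv v1 Claim 122)] -/
def IsKernelLimit {s t : ℝ} (hs : s ∈ S.I') (ht : t ∈ S.I') (z : S.ℭ.Z ⟨t, ht.1⟩)
    (ν : Measure (S.ℭ.Z ⟨s, hs.1⟩)) : Prop :=
  ∀ i (hsi : s ∈ S.G i) (hti : t ∈ S.G i)
    (x : ∀ k, (S.P (i + k)).flow.Slice ⟨t, (S.ℭ.dom_subset (i + k) (S.memDom hti k)).1⟩),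
    Tendsto (fun k ↦ S.ℭ.φ (i + k) t (S.memDom hti k) (x k)) atTop (𝓝 z) →
      Tendsto (fun k ↦ wassersteinW1 (S.kpush (i + k) hs.1 (S.memDom hsi k) (S.memDom hti k) (x k))
        ν) atTop (𝓝 0)

/-- **Claim 5.21, existence and independence**: for `s ≤ t` in `I'^{,∞}` and `z ∈ supp μ^∞_t` there
is a probability measure on `Z_s` which is the `W₁`-limit of the pushed kernels along every
approximating sequence at every stage. Independence: if `φ^{i+k}_t(x_k) → z` and
`φ^{i₀+k}_t(x⁰_k) → z`, then at equal absolute indices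
`d_{W₁}((φ_s)_* ν_{x_k;s}, (φ_s)_* ν_{x⁰_{k'};s}) ≤ d^Z_t(φ_t x_k, φ_t x⁰_{k'}) → 0`.
[cite: Bamler2023, §5.4, Lemma 5.20, Claim 5.21 (arXiv v1 Claim 122)] -/
theorem exists_isKernelLimit {s t : ℝ} (hs : s ∈ S.I') (ht : t ∈ S.I') (hst : s ≤ t)
    {z : S.ℭ.Z ⟨t, ht.1⟩} (hz : z ∈ (S.m t ht).support) :
    ∃ ν : Measure (S.ℭ.Z ⟨s, hs.1⟩), IsProbabilityMeasure ν ∧ S.IsKernelLimit hs ht z ν := by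
  obtain ⟨i₀, hs₀, ht₀⟩ := S.exists_mem_G₂ hs ht
  obtain ⟨x₀, hx₀⟩ := S.exists_seq_tendsto ht ht₀ hz
  obtain ⟨ν, hν, hlim⟩ := S.exists_tendsto_kpush hs₀ ht₀ hst hz x₀ hx₀
  refine ⟨ν, hν, fun i hsi hti x hx ↦ ?_⟩
  haveI := fun k ↦ S.isProbabilityMeasure_kpush (i + k) hs.1 (S.memDom hsi k) (S.memDom hti k) hst
    (x k)
  haveI := fun k ↦ S.isProbabilityMeasure_kpush (i₀ + k) hs.1 (S.memDom hs₀ k) (S.memDom ht₀ k) hst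
    (x₀ k)
  -- reindexing `κ k := k + i - i₀`, so that `i + k = i₀ + κ k` for `k ≥ i₀`
  have hκt : Tendsto (fun k : ℕ ↦ k + i - i₀) atTop atTop :=
    (tendsto_sub_atTop_nat i₀).comp (tendsto_add_atTop_nat i)
  -- the bound `d_{W₁}(a_k, ν) ≤ d(w_k, z) + d(z, w⁰_{κ k}) + d_{W₁}(a⁰_{κ k}, ν)` for `k ≥ i₀`
  have hbound : ∀ k, i₀ ≤ k →
      wassersteinW1 (S.kpush (i + k) hs.1 (S.memDom hsi k) (S.memDom hti k) (x k)) ν ≤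
        edist (S.ℭ.φ (i + k) t (S.memDom hti k) (x k) : S.ℭ.Z ⟨t, ht.1⟩) z +
          edist z (S.ℭ.φ (i₀ + (k + i - i₀)) t (S.memDom ht₀ (k + i - i₀)) (x₀ (k + i - i₀)) :
            S.ℭ.Z ⟨t, ht.1⟩) +
          wassersteinW1 (S.kpush (i₀ + (k + i - i₀)) hs.1 (S.memDom hs₀ (k + i - i₀))
            (S.memDom ht₀ (k + i - i₀)) (x₀ (k + i - i₀))) ν := by
    intro k hk
    have he : i + k = i₀ + (k + i - i₀) := by omega
    haveI : IsProbabilityMeasure ν := hν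
    refine (wassersteinW1_triangle (X := S.ℭ.Z ⟨s, hs.1⟩) _
      (S.kpush (i₀ + (k + i - i₀)) hs.1 (S.memDom hs₀ (k + i - i₀)) (S.memDom ht₀ (k + i - i₀))
        (x₀ (k + i - i₀))) _).trans ?_
    exact add_le_add ((S.wassersteinW1_kpush_le_edist' he hs.1 ht.1 _ _ _ _ hst _ _).trans
      (edist_triangle _ z _)) le_rfl
  -- the three error terms tend to `0`
  have h₁ : Tendsto (fun k ↦ edist (S.ℭ.φ (i + k) t (S.memDom hti k) (x k) : S.ℭ.Z ⟨t, ht.1⟩) z)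
      atTop (𝓝 0) := tendsto_iff_edist_tendsto_0.1 hx
  have h₂ : Tendsto (fun k ↦ edist z (S.ℭ.φ (i₀ + (k + i - i₀)) t (S.memDom ht₀ (k + i - i₀))
      (x₀ (k + i - i₀)) : S.ℭ.Z ⟨t, ht.1⟩)) atTop (𝓝 0) := by
    have h := (tendsto_iff_edist_tendsto_0.1 hx₀).comp hκt
    refine h.congr fun k ↦ ?_
    simp only [Function.comp_apply]
    exact edist_comm _ _
  have h₃ : Tendsto (fun k ↦ wassersteinW1 (S.kpush (i₀ + (k + i - i₀)) hs.1
      (S.memDom hs₀ (k + i - i₀)) (S.memDom ht₀ (k + i - i₀)) (x₀ (k + i - i₀))) ν) atTop (𝓝 0) :=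
    hlim.comp hκt
  have hsum := (h₁.add h₂).add h₃
  rw [add_zero, add_zero] at hsum
  refine tendsto_of_tendsto_of_tendsto_of_le_of_le' tendsto_const_nhds hsum
    (Eventually.of_forall fun _ ↦ zero_le) ?_
  filter_upwards [eventually_ge_atTop i₀] with k hk
  exact hbound k hk

open scoped Classical in
/-- **The limit conjugate heat kernel `ν^∞_{z;s} ∈ 𝒫(Z_s)`** of Claim 5.21, for `s, t ∈ I'^{,∞}` and
`z ∈ Z_t`: a choice of a probability measure with the defining property `IsKernelLimit` when one
exists (it does for `s ≤ t` and `z ∈ supp μ^∞_t`), and `0` otherwise.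
[cite: Bamler2023, §5.4, Lemma 5.20, Claim 5.21 (arXiv v1 Claim 122)] -/
def νZ {s t : ℝ} (hs : s ∈ S.I') (ht : t ∈ S.I') (z : S.ℭ.Z ⟨t, ht.1⟩) :
    Measure (S.ℭ.Z ⟨s, hs.1⟩) :=
  if h : ∃ ν : Measure (S.ℭ.Z ⟨s, hs.1⟩), IsProbabilityMeasure ν ∧ S.IsKernelLimit hs ht z ν then
    h.choose else 0

/-- The defining property of `ν^∞_{z;s}` for `s ≤ t`, `z ∈ supp μ^∞_t`.
[cite: Bamler2023, §5.4, Lemma 5.20, Claim 5.21 (arXiv v1 Claim 122)] -/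
theorem νZ_spec {s t : ℝ} (hs : s ∈ S.I') (ht : t ∈ S.I') (hst : s ≤ t) {z : S.ℭ.Z ⟨t, ht.1⟩}
    (hz : z ∈ (S.m t ht).support) :
    IsProbabilityMeasure (S.νZ hs ht z) ∧ S.IsKernelLimit hs ht z (S.νZ hs ht z) := by
  classical
  have h := S.exists_isKernelLimit hs ht hst hz
  rw [νZ, dif_pos h]
  exact h.choose_spec

/-- `ν^∞_{z;s}` is a probability measure (`s ≤ t`, `z ∈ supp μ^∞_t`).
[cite: Bamler2023, §5.4, Lemma 5.20, Claim 5.21 (arXiv v1 Claim 122)] -/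
theorem isProbabilityMeasure_νZ {s t : ℝ} (hs : s ∈ S.I') (ht : t ∈ S.I') (hst : s ≤ t)
    {z : S.ℭ.Z ⟨t, ht.1⟩} (hz : z ∈ (S.m t ht).support) : IsProbabilityMeasure (S.νZ hs ht z) :=
  (S.νZ_spec hs ht hst hz).1

/-- **Claim 5.21, convergence**: `(φ^{i+k}_s)_* ν^{i+k}_{x_k;s} → ν^∞_{z;s}` in `d_{W₁}` along every
sequence `x_k ∈ 𝒳^{i+k}_t` with `φ^{i+k}_t(x_k) → z`.
[cite: Bamler2023, §5.4, Lemma 5.20, Claim 5.21 (arXiv v1 Claim 122)] -/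
theorem tendsto_kpush_νZ {s t : ℝ} (hs : s ∈ S.I') (ht : t ∈ S.I') (hst : s ≤ t)
    {z : S.ℭ.Z ⟨t, ht.1⟩} (hz : z ∈ (S.m t ht).support) {i : ℕ} (hsi : s ∈ S.G i) (hti : t ∈ S.G i)
    (x : ∀ k, (S.P (i + k)).flow.Slice ⟨t, (S.ℭ.dom_subset (i + k) (S.memDom hti k)).1⟩)
    (hx : Tendsto (fun k ↦ S.ℭ.φ (i + k) t (S.memDom hti k) (x k)) atTop (𝓝 z)) :
    Tendsto (fun k ↦ wassersteinW1 (S.kpush (i + k) hs.1 (S.memDom hsi k) (S.memDom hti k) (x k))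
      (S.νZ hs ht z)) atTop (𝓝 0) :=
  (S.νZ_spec hs ht hst hz).2 i hsi hti x hx

/-- **Claim 5.21, support**: `supp ν^∞_{z;s} ⊆ X^∞_s = supp μ^∞_s`
(`support_subset_of_kernel_limit`,
fed with the conjugate heat flow identity `μⁿ_s = ∫ νⁿ_{x;s} dμⁿ_t` of `P n` and the `1`-Lipschitz
dependence of the kernels). [cite: Bamler2023, §5.4, Lemma 5.20, Claim 5.21 (arXiv v1 Claim 122)] -/
theorem support_νZ_subset {s t : ℝ} (hs : s ∈ S.I') (ht : t ∈ S.I') (hst : s ≤ t)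
    {z : S.ℭ.Z ⟨t, ht.1⟩} (hz : z ∈ (S.m t ht).support) :
    (S.νZ hs ht z).support ⊆ (S.m s hs).support := by
  obtain ⟨i, hsi, hti⟩ := S.exists_mem_G₂ hs ht
  obtain ⟨x, hx⟩ := S.exists_seq_tendsto ht hti hz
  haveI := S.isProbabilityMeasure_νZ hs ht hst hz
  haveI := fun k (y : (S.P (i + k)).flow.Slice ⟨t, (S.ℭ.dom_subset (i + k) (S.memDom hti k)).1⟩) ↦
    (S.P (i + k)).flow.isProbabilityMeasure_condKernel y
      (s := ⟨s, (S.ℭ.dom_subset (i + k) (S.memDom hsi k)).1⟩) hst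
  haveI := fun k ↦ (S.P (i + k)).isProbabilityMeasure_μ
    ⟨t, (S.ℭ.dom_subset (i + k) (S.memDom hti k)).1⟩
  haveI := fun k ↦ (S.P (i + k)).isProbabilityMeasure_μ
    ⟨s, (S.ℭ.dom_subset (i + k) (S.memDom hsi k)).1⟩
  refine support_subset_of_kernel_limit (Zs := S.ℭ.Z ⟨s, hs.1⟩) (Zt := S.ℭ.Z ⟨t, ht.1⟩)
    (fun k ↦ S.ℭ.φ (i + k) s (S.memDom hsi k)) (fun k ↦ S.ℭ.φ (i + k) t (S.memDom hti k))
    (fun k ↦ S.ℭ.isometry (i + k) s (S.memDom hsi k))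
    (fun k ↦ S.ℭ.isometry (i + k) t (S.memDom hti k))
    (fun k y ↦ (S.P (i + k)).flow.condKernel y ⟨s, (S.ℭ.dom_subset (i + k) (S.memDom hsi k)).1⟩)
    (fun k y y' ↦ (S.hP (i + k)).wassersteinW1_condKernel_le_edist hst y y')
    (fun k ↦ (S.P (i + k)).μ ⟨t, (S.ℭ.dom_subset (i + k) (S.memDom hti k)).1⟩)
    (fun k ↦ (S.P (i + k)).μ ⟨s, (S.ℭ.dom_subset (i + k) (S.memDom hsi k)).1⟩)
    (fun k f hf ↦ ?_) (S.m t ht) (S.m s hs) (S.tendsto_push_m ht hti) (S.tendsto_push_m hs hsi)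
    hz x hx (S.νZ hs ht z) (S.tendsto_kpush_νZ hs ht hst hz hsi hti x hx)
  -- the conjugate heat flow identity of `P (i + k)` in `lintegral` form
  exact S.lintegral_μ_eq_lintegral_lintegral (i + k) hst hf

/-- `ν^∞_{z;s}` gives no mass to the complement of `X^∞_s`.
[cite: Bamler2023, §5.4, Lemma 5.20, Claim 5.21 (arXiv v1 Claim 122)] -/
theorem νZ_compl_support {s t : ℝ} (hs : s ∈ S.I') (ht : t ∈ S.I') (hst : s ≤ t)
    {z : S.ℭ.Z ⟨t, ht.1⟩} (hz : z ∈ (S.m t ht).support) :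
    S.νZ hs ht z (S.m s hs).supportᶜ = 0 :=
  measure_mono_null (compl_subset_compl.2 (S.support_νZ_subset hs ht hst hz))
    Measure.measure_compl_support

end ChainSetup

end MetricFlowPair

end Literature.Geometry.Riemannian

end
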